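import Summits.ResolutionOfSingularities.ResolutionOfSingularities.Theorems.FrobeniusClosingPatchingRelPerfectOfAtom
import Summits.ResolutionOfSingularities.ResolutionOfSingularities.Theorems.FrobeniusClosingPatchingRelPerfectAtomDimLeThree
import Summits.ResolutionOfSingularities.ResolutionOfSingularities.Theorems.UniversalCellsLocalToGlobalSandwichedStrongPin
import HarnessLib

/-!
# Crux `PatchingRelPerfect` (stmt-ResolutionOfSingularities-16161), line `closed-point-slice`:
# the crux CLOSED MODULO the dimension-EXACTLY-4 atom (CONDITIONAL certificate, v3 of the line)

Sequel of `FrobeniusClosingPatchingRelPerfectOfAtom.lean`. There the crux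
`FrobeniusClosing.PatchingRelPerfect` (= `∀ p prime, RelLUPerfect p → ResPerfect p`, one term
shared by eight routes) was derived from Cossart–Piltant 2019 (Thm. 1.1, Prop. 4.4), the ATOM
`PunctualCompletePerfect p 4` (punctual resolution in single-blow-up format over complete regular
local bases of dimension `≤ 4` with perfect residue field) and the dimension-`≥ 5` residual. With
`Theorems.stub_atomDimLeThree` landed (the atom for bases of dimension `≤ 3`, from Cossart–Piltant
Thm. 1.1 + Prop. 4.4 through the twin crux's format upgrade, and Cossart–Jannsen–Saito 2020
Thm. 1.2 in single-blow-up format for bases of dimension `≤ 2`), the open local input shrinks to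
bases of dimension EXACTLY `4`:

* `punctualCompletePerfect_four_of_printed_of_atomDimFour` — the atom `PunctualCompletePerfect p 4`
  from the printed inputs and its dimension-`= 4` stratum (case split on `ringKrullDim S ≤ 3`).
* `patchingRelPerfect_of_printed_of_atomDimFour_of_dimGeFive` — **the crux BY NAME from:
  `CossartPiltant2019General`, `CossartPiltant2019Principalization`, CJS 2020 Thm. 1.2 in
  single-blow-up format (all printed), the dimension-EXACTLY-4 atom, and the dimension-`≥ 5`
  residual.** A CONDITIONAL result; the item stays open. This is the certificate of the line's v3
  state: for this crux everything except "local resolution, in blow-up format, of integral schemes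
  proper and birational over `κ[[x₁,x₂,x₃,x₄]]` (`κ` perfect of characteristic `p`) which are
  regular off the closed fibre" and "dimension `≥ 5`" is a theorem of the tree (modulo the printed
  dimension-`≤ 3` theorems).

## References

* V. Cossart, O. Piltant, J. Algebra 529 (2019), Thm. 1.1, Prop. 4.4, Rem. 3.2. [CossartPiltant2019]
* V. Cossart, U. Jannsen, S. Saito, LNM 2270 (2020), Thm. 1.2. [CossartJannsenSaito2020]
* M. Temkin, Adv. Math. 219 (2008), Prop. 2.3.4, Lemma 2.1.1, Lemma 2.1.4. [Temkin2008]
* O. Piltant, RACSAM 107 (2013), p. 2, Prop. 5.1, Cor. 5.7. [Piltant2013]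
-/

-- `Summit.<Summit>.<Sub>.Theorems` with `Sub = Summit` (single-conjunct summit, D-0017)
set_option linter.dupNamespace false

noncomputable section

open CategoryTheory CategoryTheory.Limits AlgebraicGeometry Literature.AlgebraicGeometry.Resolution

namespace Summit.ResolutionOfSingularities.ResolutionOfSingularities.Theorems

/-- **The atom `PunctualCompletePerfect p 4` from the printed dimension-`≤ 3` theorems and its
dimension-EXACTLY-4 stratum**: a Noetherian local ring of dimension `≤ 4` has dimension `≤ 3` or
exactly `4` (`topologicalKrullDim_eq_four_of_le_four_of_not_le_three` on `WithBot ℕ∞`); the first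
case is `stub_atomDimLeThree`. [cite: CossartPiltant2019, Thm. 1.1 and Prop. 4.4; CossartJannsenSaito2020, Thm. 1.2] -/
theorem punctualCompletePerfect_four_of_printed_of_atomDimFour (p : ℕ) (hp : p.Prime)
    (hG : CossartPiltant2019General.{0}) (hP : CossartPiltant2019Principalization.{0})
    (hCJS : ∀ (X : Scheme.{0}) [IsNoetherian X] [IsReduced X], Scheme.IsExcellent X →
      topologicalKrullDim X ≤ 2 → Scheme.AdmitsDesingularization X)
    (hA4 : ∀ (S : Type) [CommRing S] [IsRegularLocalRing S] [CharP S p]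
      [IsAdicComplete (IsLocalRing.maximalIdeal S) S]
      [PerfectField (IsLocalRing.ResidueField S)], ringKrullDim S = (4 : ℕ) →
      ∀ (T : Scheme.{0}) (f : T ⟶ Spec (.of S)), IsIntegral T → IsProper f → IsBirational f →
        (∀ t : T, f.base t ≠ IsLocalRing.closedPoint S → IsRegularLocalRing (T.presheaf.stalk t)) →
        ∃ (J : T.IdealSheafData) (T' : Scheme.{0}) (π : T' ⟶ T), J ≠ ⊥ ∧
          (∀ t : T, t ∈ J.support → f.base t = IsLocalRing.closedPoint S) ∧
          IsBlowup π J ∧ Scheme.IsRegular T')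
    (S : Type) [CommRing S] [IsRegularLocalRing S] [CharP S p]
    [IsAdicComplete (IsLocalRing.maximalIdeal S) S] [PerfectField (IsLocalRing.ResidueField S)]
    (hdim : ringKrullDim S ≤ (4 : ℕ)) (T : Scheme.{0}) (f : T ⟶ Spec (.of S))
    [IsIntegral T] [IsProper f] (hbir : IsBirational f)
    (hoff : ∀ t : T, f.base t ≠ IsLocalRing.closedPoint S → IsRegularLocalRing (T.presheaf.stalk t)) :
    ∃ (J : T.IdealSheafData) (T' : Scheme.{0}) (π : T' ⟶ T), J ≠ ⊥ ∧
      (∀ t : T, t ∈ J.support → f.base t = IsLocalRing.closedPoint S) ∧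
      IsBlowup π J ∧ Scheme.IsRegular T' := by
  by_cases h3 : ringKrullDim S ≤ (3 : ℕ)
  · exact stub_atomDimLeThree p hp hG hP hCJS S h3 T f hbir hoff
  · exact hA4 S (topologicalKrullDim_eq_four_of_le_four_of_not_le_three hdim h3) T f
      inferInstance inferInstance hbir hoff

/-- **The crux `FrobeniusClosing.PatchingRelPerfect` BY NAME, from the printed dimension-`≤ 3`
theorems (Cossart–Piltant 2019 Thm. 1.1 and Prop. 4.4; Cossart–Jannsen–Saito 2020 Thm. 1.2 in
single-blow-up format), the dimension-EXACTLY-4 ATOM, and the dimension-`≥ 5` residual.** The open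
content of the crux, after line `closed-point-slice` v3, is exactly the last two hypotheses. A
CONDITIONAL result; the item stays open.
[cite: CossartPiltant2019, Thm. 1.1 and Prop. 4.4; CossartJannsenSaito2020, Thm. 1.2; Temkin2008, Prop. 2.3.4; Piltant2013, p. 2] -/
theorem patchingRelPerfect_of_printed_of_atomDimFour_of_dimGeFive
    (hG : CossartPiltant2019General.{0}) (hP : CossartPiltant2019Principalization.{0})
    (hCJS : ∀ (X : Scheme.{0}) [IsNoetherian X] [IsReduced X], Scheme.IsExcellent X →
      topologicalKrullDim X ≤ 2 → Scheme.AdmitsDesingularization X)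
    (hA4 : ∀ (p : ℕ), p.Prime → ∀ (S : Type) [CommRing S] [IsRegularLocalRing S] [CharP S p]
      [IsAdicComplete (IsLocalRing.maximalIdeal S) S]
      [PerfectField (IsLocalRing.ResidueField S)], ringKrullDim S = (4 : ℕ) →
      ∀ (T : Scheme.{0}) (f : T ⟶ Spec (.of S)), IsIntegral T → IsProper f → IsBirational f →
        (∀ t : T, f.base t ≠ IsLocalRing.closedPoint S → IsRegularLocalRing (T.presheaf.stalk t)) →
        ∃ (J : T.IdealSheafData) (T' : Scheme.{0}) (π : T' ⟶ T), J ≠ ⊥ ∧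
          (∀ t : T, t ∈ J.support → f.base t = IsLocalRing.closedPoint S) ∧
          IsBlowup π J ∧ Scheme.IsRegular T')
    (h5 : ∀ (p : ℕ), p.Prime →
      (∀ (k K : Type) [Field k] [CharP k p] [PerfectField k] [Field K] [Algebra k K],
        (⊤ : IntermediateField k K).FG → ∀ O : ValuationSubring K, (∀ c : k, algebraMap k K c ∈ O) →
          ∀ R : Subalgebra k K, R.FG → R.toSubring ≤ O.toSubring →
            ∃ (A : Subalgebra k K) (h : A.toSubring ≤ O.toSubring), R ≤ A ∧ A.FG ∧
              IsFractionRing A K ∧ IsRegularLocalRing (Localization.AtPrime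
                (Ideal.comap (Subring.inclusion h) (IsLocalRing.maximalIdeal O)))) →
      ∀ (k : Type) [Field k] [CharP k p] [PerfectField k] (X : Scheme.{0}) (f : X ⟶ Spec (.of k)),
        IsSeparated f → LocallyOfFiniteType f → QuasiCompact f → IsIntegral X →
        ¬ topologicalKrullDim X ≤ 4 → Scheme.HasResolution X) :
    Summit.ResolutionOfSingularities.ResolutionOfSingularities.Theses.FrobeniusClosing.PatchingRelPerfect :=
  patchingRelPerfect_of_cossartPiltant_of_atom_of_dimGeFive hG hP
    (fun p hp S _ _ _ _ _ hdim T f hT hf hbir hoff =>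
      @punctualCompletePerfect_four_of_printed_of_atomDimFour p hp hG hP hCJS (hA4 p hp) S _ _ _ _ _
        hdim T f hT hf hbir hoff)
    h5

end Summit.ResolutionOfSingularities.ResolutionOfSingularities.Theorems

end
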